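import Summits.QuantumFields.YangMills.Theorems.MirrorModularBoostsHypercubicLimitPlaneLimitsDefs
import Summits.QuantumFields.YangMills.Theorems.MirrorModularBoostsHypercubicLimitClosureHalvesDefs
import Summits.QuantumFields.YangMills.Theorems.LangevinControlUVOSLegsAtWeakCouplingCDefs
import Literature.MathematicalPhysics.QuantumFieldTheory.SchwingerLimitInheritance
import Literature.MathematicalPhysics.QuantumLattice.SchwingerGrowthTwoFactor
import HarnessLib

/-!
# Crux `WeakCouplingHypercubicLimit` (stmt-QuantumFields-16120), line `Sketch`, r10 toolkit: moving test functions
along a `PlaneLimits` package (sub-goal SG-C `planeDist_tendsto_of_tendsto`)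

Helper file of the lead (c4) for the r10 skeleton `Cruxes/WeakCouplingHypercubicLimit/Lines/Sketch.lean`.  The
skeleton passes lattice identities to the continuum limit along a `PlaneLimits r sch φ T` package
(`MirrorModularBoostsHypercubicLimitPlaneLimitsDefs`: `planeDist r sch (φ k) n q F → T n q F` for every OFF-DIAGONAL
`F`) under the `k`-uniform E0′-type bound `UniformFunctionalBoundPlanes r sch`
(`‖planeDist r sch k n q F‖ ≤ α (n!)^β |F|_{n s}` for all `k` and all off-diagonal `F`).  The reflected / translated
test functions of the lattice identities MOVE with `k`, so the lead needs the joint-continuity statement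

* `planeDist_tendsto_of_tendsto` (SG-C): if `H k → H₀` in `𝓢` with all `H k` and `H₀` off-diagonal, then
  `planeDist r sch (φ k) n q (H k) → T n q H₀`.

Proof (equicontinuity, as in the Literature's `translateMulti_apply_eq_of_tendsto`,
`Literature/MathematicalPhysics/QuantumFieldTheory/SchwingerLimitInheritance`):
`planeDist (φ k) (H k) − T H₀ = planeDist (φ k) (H k − H₀) + (planeDist (φ k) H₀ − T H₀)`; the first term is bounded
by `α (n!)^β |H k − H₀|_{n s} → 0` since `H k − H₀ ∈ ⁰𝒮` (`IsOffDiagonal.sub`) and `G ↦ |G|_{n s}` is continuous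
(`continuous_schwartzNorm`, `Literature/MathematicalPhysics/QuantumLattice/SchwingerGrowthTwoFactor`), the second
tends to `0` by `PlaneLimits.1`.

Refs: OsterwalderSchraderCMP1975 §2, §4; GlimmJaffe1987 §6.1.
-/

noncomputable section

open scoped SchwartzMap BigOperators ComplexConjugate
open MeasureTheory Filter Topology
open Literature.MathematicalPhysics.QuantumFieldTheory Literature.MathematicalPhysics.QuantumLattice
open Literature.MathematicalPhysics.AQFT
open Literature.Probability.LatticeModels (box Site)
open Summit.QuantumFields.YangMills.Cruxes.HypercubicLimit.CouplingResponse
open Summit.QuantumFields.YangMills.Cruxes.OSLegsFromFemtoAndGap.DlrCollarTransfer (plane conn Decay RPPos ConnCS)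
open Summit.QuantumFields.YangMills.Cruxes.OSLegsAtWeakCouplingC.Sketch (Separated)
open Summit.QuantumFields.YangMills.Theorems.OSLegsFromFemtoAndGap

namespace Summit.QuantumFields.YangMills.Theorems.WeakCouplingHypercubicLimit.TraceNormColdPressure

/-- If `H k → H₀` in `𝓢`, then `|H k − H₀|_m → 0` for every Schwartz norm `|·|_m` (continuity of the finite sup of
Schwartz seminorms, the Literature's `continuous_schwartzNorm`). [folklore] -/
theorem tendsto_schwartzNorm_sub_of_tendsto {X : Type*} [NormedAddCommGroup X] [NormedSpace ℝ X]
    (m : ℕ) {H : ℕ → 𝓢(X, ℂ)} {H₀ : 𝓢(X, ℂ)} (hH : Tendsto H atTop (𝓝 H₀)) :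
    Tendsto (fun k => schwartzNorm m (H k - H₀)) atTop (𝓝 0) := by
  have h1 : Tendsto (fun k => H k - H₀) atTop (𝓝 0) := by
    simpa using hH.sub (tendsto_const_nhds (x := H₀))
  have h2 := ((continuous_schwartzNorm m).tendsto 0).comp h1
  rwa [show schwartzNorm m (0 : 𝓢(X, ℂ)) = 0 from map_zero _] at h2

/-- **Registered sub-goal `planeDist_tendsto_of_tendsto` (SG-C, line `Sketch`, r10 toolkit): moving test functions.**
Along a `PlaneLimits r sch φ T` package with the `k`-uniform functional bound `UniformFunctionalBoundPlanes r sch`,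
`planeDist` of a Schwartz-convergent sequence `H k → H₀` of off-diagonal test functions converges to the limit
functional at the limit: `planeDist r sch (φ k) n q (H k) → T n q H₀` (equicontinuity on `⁰𝒮` from the uniform
bound, `IsOffDiagonal.sub`, continuity of `|·|_{n s}` on `𝓢`, and `PlaneLimits.1` at `H₀`). [folklore] -/
theorem planeDist_tendsto_of_tendsto :
    ∀ (G : Type) [Group G] [TopologicalSpace G] [IsTopologicalGroup G] [CompactSpace G]
      [MeasurableSpace G] [BorelSpace G] (r : LatticeRep G) (sch : SpeciesScheme (YMSpecies G))
      (φ : ℕ → ℕ) (T : (n : ℕ) → (Fin n → Plane) → (𝓢((Fin n → EuclideanSpace ℝ (Fin 4)), ℂ) →L[ℂ] ℂ)),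
      UniformFunctionalBoundPlanes r sch → PlaneLimits r sch φ T →
      ∀ (n : ℕ) (q : Fin n → Plane) (H : ℕ → 𝓢((Fin n → EuclideanSpace ℝ (Fin 4)), ℂ))
        (H₀ : 𝓢((Fin n → EuclideanSpace ℝ (Fin 4)), ℂ)),
        (∀ k, IsOffDiagonal (H k)) → IsOffDiagonal H₀ → Tendsto H atTop (𝓝 H₀) →
        Tendsto (fun k => planeDist r sch (φ k) n q (H k)) atTop (𝓝 (T n q H₀)) := by
  intro G _ _ _ _ _ _ r sch φ T hU hP n q H H₀ hH hH₀ hlim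
  obtain ⟨s, α, β, hb⟩ := hU
  -- `|H k − H₀|_{n s} → 0`
  have hN : Tendsto (fun k => schwartzNorm (n * s) (H k - H₀)) atTop (𝓝 0) :=
    tendsto_schwartzNorm_sub_of_tendsto (n * s) hlim
  -- equicontinuity: `planeDist (φ k) (H k − H₀) → 0`
  have h3 : Tendsto (fun k => planeDist r sch (φ k) n q (H k - H₀)) atTop (𝓝 0) := by
    refine squeeze_zero_norm (fun k => hb n q (H k - H₀) ((hH k).sub hH₀) (φ k)) ?_
    simpa using hN.const_mul (α * (n.factorial : ℝ) ^ β)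
  -- `planeDist (φ k) H₀ → T H₀`
  have h4 := h3.add (hP.1 n q H₀ hH₀)
  rw [zero_add] at h4
  refine h4.congr fun k => ?_
  rw [map_sub, sub_add_cancel]

end Summit.QuantumFields.YangMills.Theorems.WeakCouplingHypercubicLimit.TraceNormColdPressure

end
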